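import Summits.ResolutionOfSingularities.ResolutionOfSingularities.Theorems.FrobeniusLadderFInjectiveMacaulayficationGermForm
import Literature.AlgebraicGeometry.Resolution.BlowupsLocal
import Literature.AlgebraicGeometry.Resolution.IdealSheafLemmas
import Literature.AlgebraicGeometry.Resolution.AffineBlowupCartier
import Mathlib.Algebra.Category.Ring.Instances
import HarnessLib

/-!
# TRANSPORT OF THE F-HALF'S GERM STATEMENTS ALONG ISOMORPHISMS OF GERMS: `FInjectivizationGermAt` and the census row shape ⟨legal, not full, cured⟩
# (crux `FInjectiveMacaulayfication` stmt-ResolutionOfSingularities-15315, chain w45a; res-L1-w45a-plan-1 RULINGS R22.1 (6), R22.2, R22.4 (2) «stub-1: ★ TRANSPORT LEMMA (HIGH): (a) a ring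
# iso of stalks / an iso of k-schemes sending v ↦ v′ transports `GermForm.FInjectivizationGermAt p v`, the census conjunction shape (LEGAL ∧ ¬F(e)-iso ∧ CURED) …; (b) instance
# the k-algebra automorphism σ_b : z ↦ z + x^b; (c) class theorem for f∘σ + cover data ⇒ row for V(f)»; seat res-L1-w45a-stub-1 g13. THIS FILE = (a), GENERIC.)

[OURS · L1 W4.5a] Support file (`--supports stmt-ResolutionOfSingularities-15315 --as helper`); def-free; UNCONDITIONAL; no named fact; NOT a statement of any manuscript.
Nothing of the crux is proved. AI-written (AI review is weaker than expert review).

* §1 Along an isomorphism of local schemes `Φ : Spec 𝒪_{X,x} ≅ Spec 𝒪_{X′,x′}` fixing the closed points: `fInjectivizationGermAt_transport` (the ∃-germ predicate) and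
  ★★ `rowShape_transport` — the census conjunction VERBATIM for centres `J′.comap Φ = J`: LEGAL (J ≠ ⊥ ∧ Supp J ⊆ Singᶜᶜ ∧ S′ regular off the closed fibre ∧ CMCl everywhere)
  ∧ NOT FULL (∃ s over the closed point, ¬FullCl) ∧ CURED (∃ 𝓚 ≠ ⊥ fibre-supported, all blow-ups FullCl): the blown-up schemes `S′` are the same objects re-based by
  `g ↦ g ≫ Φ⁻¹` (`IsBlowup.comp_iso`); only the closed-point conditions and the two germ-side conjuncts move.
* §2 The constructor from a ring isomorphism `τ : A ≃+* A′`, `x′ ∈ Spec A′`, `x := (Spec τ)(x′)`: `exists_germIso_specMap` — an iso of germs fixing the closed points and matching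
  the pulled-back centres `I~` and `(τ I)~` (`Scheme.SpecMap_stalkMap_fromSpecStalk`, `comap_ofIdealTop_SpecMap`).
* §3 ★★ `rowShape_of_ringEquiv`, `fInjectivizationGermAt_of_ringEquiv` — row / germ for `(Spec A, I)` at `(Spec τ) x′` ⇒ row / germ for `(Spec A′, τ I)` at `x′`.
[cite: GortzWedhorn2020, (13.19)] [cite: StacksProject, Tag 01J7 and Tag 0804]
-/

-- single-problem summit: the doubled namespace component is forced
set_option linter.dupNamespace false

noncomputable section

namespace Summit.ResolutionOfSingularities.ResolutionOfSingularities.Theorems.FInjectiveMacaulayfication.GermRowTransport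

open CategoryTheory CategoryTheory.Limits AlgebraicGeometry TopologicalSpace IsLocalRing
open Literature.AlgebraicGeometry.Resolution
open Summit.ResolutionOfSingularities.ResolutionOfSingularities.Theorems.FInjectiveMacaulayfication
open SliceableCentre GermForm

/-! ## §1 Along an isomorphism of germs -/

/-- Plumbing: an iso of local schemes fixing the closed points identifies the «lies over the closed point» conditions. [plumbing] -/
theorem inv_base_eq_closedPoint_iff {X X' : Scheme.{0}} {x : X} {x' : X'} (Φ : Spec (X.presheaf.stalk x) ≅ Spec (X'.presheaf.stalk x'))
    (hΦ : Φ.hom.base (closedPoint (X.presheaf.stalk x)) = closedPoint (X'.presheaf.stalk x')) (y : Spec (X'.presheaf.stalk x')) :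
    Φ.inv.base y = closedPoint (X.presheaf.stalk x) ↔ y = closedPoint (X'.presheaf.stalk x') := by
  constructor
  · intro h
    have : Φ.hom.base (Φ.inv.base y) = y := by
      rw [← Scheme.Hom.comp_apply, Φ.inv_hom_id]
      rfl
    rw [← this, h, hΦ]
  · intro h
    rw [h, ← hΦ, ← Scheme.Hom.comp_apply, Φ.hom_inv_id]
    rfl

/-- **`FInjectivizationGermAt` transports along an isomorphism of germs fixing the closed points.** [folklore; cite: GortzWedhorn2020, (13.19)] -/
theorem fInjectivizationGermAt_transport (p : ℕ) {X X' : Scheme.{0}} {x : X} {x' : X'} (Φ : Spec (X.presheaf.stalk x) ≅ Spec (X'.presheaf.stalk x'))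
    (hΦ : Φ.hom.base (closedPoint (X.presheaf.stalk x)) = closedPoint (X'.presheaf.stalk x')) (h : FInjectivizationGermAt p x) :
    FInjectivizationGermAt p x' := by
  obtain ⟨𝓚, h𝓚, hsupp, hfull⟩ := h
  refine ⟨𝓚.comap Φ.inv, ?_, ?_, ?_⟩
  · intro h0
    apply h𝓚
    have : (𝓚.comap Φ.inv).comap Φ.hom = 𝓚 := by
      rw [← Scheme.IdealSheafData.comap_comp, Φ.hom_inv_id, Scheme.IdealSheafData.comap_id]
    rw [← this, h0, Scheme.IdealSheafData.comap_bot]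
  · intro s hs
    rw [Scheme.IdealSheafData.support_comap] at hs
    exact (inv_base_eq_closedPoint_iff Φ hΦ s).mp (hsupp _ hs)
  · intro S'' π hπ s
    have hB : IsBlowup (π ≫ Φ.inv) ((𝓚.comap Φ.inv).comap Φ.hom) := hπ.comp_iso Φ.symm
    rw [← Scheme.IdealSheafData.comap_comp, Φ.hom_inv_id, Scheme.IdealSheafData.comap_id] at hB
    exact hfull S'' (π ≫ Φ.inv) hB s

/-- ★★ **THE CENSUS ROW SHAPE TRANSPORTS ALONG AN ISOMORPHISM OF GERMS** fixing the closed points and matching the centres (`J′.comap Φ = J`): ⟨LEGAL, NOT FULL, CURED⟩ for every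
blowing up of `Spec 𝒪_{X,x}` along `J` ⇒ the same for every blowing up of `Spec 𝒪_{X′,x′}` along `J′`. [folklore; cite: GortzWedhorn2020, (13.19)] -/
theorem rowShape_transport (p : ℕ) {X X' : Scheme.{0}} {x : X} {x' : X'} (Φ : Spec (X.presheaf.stalk x) ≅ Spec (X'.presheaf.stalk x'))
    (hΦ : Φ.hom.base (closedPoint (X.presheaf.stalk x)) = closedPoint (X'.presheaf.stalk x'))
    (J : (Spec (X.presheaf.stalk x)).IdealSheafData) (J' : (Spec (X'.presheaf.stalk x')).IdealSheafData) (hJ : J'.comap Φ.hom = J)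
    (h : ∀ (S' : Scheme.{0}) (g : S' ⟶ Spec (X.presheaf.stalk x)), IsBlowup g J →
      (J ≠ ⊥ ∧ ((J.support : Set (Spec (X.presheaf.stalk x))) ⊆ (Scheme.regularLocus (Spec (X.presheaf.stalk x)))ᶜ) ∧
        (∀ s : S', g.base s ≠ closedPoint (X.presheaf.stalk x) → s ∈ Scheme.regularLocus S') ∧ (∀ s : S', CMCl (S'.presheaf.stalk s))) ∧
      (∃ s : S', g.base s = closedPoint (X.presheaf.stalk x) ∧ ¬ FullCl p (S'.presheaf.stalk s)) ∧
      (∃ 𝓚 : S'.IdealSheafData, 𝓚 ≠ ⊥ ∧ (∀ s ∈ (𝓚.support : Set S'), g.base s = closedPoint (X.presheaf.stalk x)) ∧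
        ∀ (S'' : Scheme.{0}) (π : S'' ⟶ S'), IsBlowup π 𝓚 → ∀ s : S'', FullCl p (S''.presheaf.stalk s))) :
    ∀ (S' : Scheme.{0}) (g' : S' ⟶ Spec (X'.presheaf.stalk x')), IsBlowup g' J' →
      (J' ≠ ⊥ ∧ ((J'.support : Set (Spec (X'.presheaf.stalk x'))) ⊆ (Scheme.regularLocus (Spec (X'.presheaf.stalk x')))ᶜ) ∧
        (∀ s : S', g'.base s ≠ closedPoint (X'.presheaf.stalk x') → s ∈ Scheme.regularLocus S') ∧ (∀ s : S', CMCl (S'.presheaf.stalk s))) ∧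
      (∃ s : S', g'.base s = closedPoint (X'.presheaf.stalk x') ∧ ¬ FullCl p (S'.presheaf.stalk s)) ∧
      (∃ 𝓚 : S'.IdealSheafData, 𝓚 ≠ ⊥ ∧ (∀ s ∈ (𝓚.support : Set S'), g'.base s = closedPoint (X'.presheaf.stalk x')) ∧
        ∀ (S'' : Scheme.{0}) (π : S'' ⟶ S'), IsBlowup π 𝓚 → ∀ s : S'', FullCl p (S''.presheaf.stalk s)) := by
  intro S' g' hg'
  -- re-base the blowing up
  have hg : IsBlowup (g' ≫ Φ.inv) J := by
    have := hg'.comp_iso Φ.symm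
    rw [show Φ.symm.inv = Φ.hom from rfl, hJ] at this
    exact this
  obtain ⟨⟨hne, hsupp, hreg, hcm⟩, ⟨s₀, hs₀, hnf⟩, ⟨𝓚, h𝓚, h𝓚supp, h𝓚full⟩⟩ := h S' (g' ≫ Φ.inv) hg
  have hpt : ∀ s : S', (g' ≫ Φ.inv).base s = closedPoint (X.presheaf.stalk x) ↔ g'.base s = closedPoint (X'.presheaf.stalk x') := fun s => by
    rw [Scheme.Hom.comp_apply]
    exact inv_base_eq_closedPoint_iff Φ hΦ (g'.base s)
  refine ⟨⟨?_, ?_, fun s hs => hreg s (fun h => hs ((hpt s).mp h)), hcm⟩, ⟨s₀, (hpt s₀).mp hs₀, hnf⟩,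
    ⟨𝓚, h𝓚, fun s hs => (hpt s).mp (h𝓚supp s hs), h𝓚full⟩⟩
  · -- `J′ ≠ ⊥`
    intro h0
    apply hne
    rw [← hJ, h0, Scheme.IdealSheafData.comap_bot]
  · -- `Supp J′ ⊆ Singᶜᶜ`
    intro y hy hreg'
    have hy' : Φ.inv.base y ∈ (J.support : Set (Spec (X.presheaf.stalk x))) := by
      rw [← hJ, Scheme.IdealSheafData.support_comap]
      show Φ.hom.base (Φ.inv.base y) ∈ (J'.support : Set _)
      rw [← Scheme.Hom.comp_apply, Φ.inv_hom_id]
      exact hy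
    apply hsupp hy'
    -- regularity descends along the iso `Φ.inv`
    change IsRegularLocalRing ((Spec (X'.presheaf.stalk x')).presheaf.stalk y) at hreg'
    change IsRegularLocalRing ((Spec (X.presheaf.stalk x)).presheaf.stalk (Φ.inv.base y))
    haveI := hreg'
    exact IsRegularLocalRing.of_ringEquiv (asIso (Φ.inv.stalkMap y)).commRingCatIsoToRingEquiv.symm

/-! ## §2 The isomorphism of germs induced by a ring isomorphism -/

/-- ★ **Germs along `Spec` of a ring isomorphism.** `τ : A ≃+* A′`, `x′ ∈ Spec A′`, `x := (Spec τ)(x′)`: an isomorphism of local schemes `Φ : Spec 𝒪_{Spec A,x} ≅ Spec 𝒪_{Spec A′,x′}`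
fixing the closed points under which the pulled-back centre of `τ(I)` restricts to the pulled-back centre of `I`, for every ideal `I ⊆ A`.
[folklore; cite: StacksProject, Tag 01J7] -/
theorem exists_germIso_specMap {A A' : Type} [CommRing A] [CommRing A'] (τ : A ≃+* A') (x' : Spec (.of A')) (I : Ideal A) :
    ∃ Φ : Spec ((Spec (.of A)).presheaf.stalk ((Spec.map (CommRingCat.ofHom τ.toRingHom)).base x')) ≅ Spec ((Spec (.of A')).presheaf.stalk x'),
      Φ.hom.base (closedPoint _) = closedPoint _ ∧
      ((affineBlowup.idealSheaf (I.map τ.toRingHom)).comap ((Spec (.of A')).fromSpecStalk x')).comap Φ.hom =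
        (affineBlowup.idealSheaf I).comap ((Spec (.of A)).fromSpecStalk ((Spec.map (CommRingCat.ofHom τ.toRingHom)).base x')) := by
  set Ψ : Spec (.of A') ⟶ Spec (.of A) := Spec.map (CommRingCat.ofHom τ.toRingHom) with hΨ
  haveI : IsIso Ψ := by
    rw [hΨ, show CommRingCat.ofHom τ.toRingHom = τ.toCommRingCatIso.hom from rfl]
    infer_instance
  -- the stalk map of the iso `Ψ` at `x′`
  let e : (Spec (.of A)).presheaf.stalk (Ψ.base x') ⟶ (Spec (.of A')).presheaf.stalk x' := Ψ.stalkMap x'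
  haveI : IsIso e := inferInstance
  let Φ : Spec ((Spec (.of A)).presheaf.stalk (Ψ.base x')) ≅ Spec ((Spec (.of A')).presheaf.stalk x') := (asIso (Spec.map e)).symm
  refine ⟨Φ, ?_, ?_⟩
  · -- closed point ↦ closed point: `Spec e` is local
    haveI : IsLocalHom e.hom := isLocalHom_of_isIso e
    have h1 : (Spec.map e).base (closedPoint ((Spec (.of A')).presheaf.stalk x')) = closedPoint ((Spec (.of A)).presheaf.stalk (Ψ.base x')) :=
      Spec_closedPoint
    show Φ.hom.base (closedPoint _) = closedPoint _
    rw [← h1, show Φ.hom = inv (Spec.map e) from rfl, ← Scheme.Hom.comp_apply, IsIso.hom_inv_id]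
    rfl
  · -- centres: `Spec e ≫ fromSpecStalk x = fromSpecStalk x′ ≫ Ψ` and `I~.comap Ψ = (τ I)~`
    have hnat : Spec.map e ≫ (Spec (.of A)).fromSpecStalk (Ψ.base x') = (Spec (.of A')).fromSpecStalk x' ≫ Ψ :=
      Scheme.SpecMap_stalkMap_fromSpecStalk Ψ
    have hI : (affineBlowup.idealSheaf I).comap Ψ = affineBlowup.idealSheaf (I.map τ.toRingHom) := comap_ofIdealTop_SpecMap τ.toRingHom I
    have key : ((affineBlowup.idealSheaf I).comap ((Spec (.of A)).fromSpecStalk (Ψ.base x'))).comap (Spec.map e) =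
        (affineBlowup.idealSheaf (I.map τ.toRingHom)).comap ((Spec (.of A')).fromSpecStalk x') := by
      rw [← Scheme.IdealSheafData.comap_comp, hnat, Scheme.IdealSheafData.comap_comp, hI]
    rw [← key, ← Scheme.IdealSheafData.comap_comp, show Φ.hom = inv (Spec.map e) from rfl, IsIso.inv_hom_id, Scheme.IdealSheafData.comap_id]

/-! ## §3 ★★ Row and germ along a ring isomorphism -/

/-- ★★ **THE CENSUS ROW ALONG A RING ISOMORPHISM.** `τ : A ≃+* A′`, `x′ ∈ Spec A′`, `I ⊆ A`: the row ⟨legal, not full, cured⟩ for the blowings up of `Spec 𝒪_{Spec A,(Spec τ)x′}`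
along `I~` gives the row for the blowings up of `Spec 𝒪_{Spec A′,x′}` along `(τ I)~`. [folklore; cite: GortzWedhorn2020, (13.19)] -/
theorem rowShape_of_ringEquiv (p : ℕ) {A A' : Type} [CommRing A] [CommRing A'] (τ : A ≃+* A') (x' : Spec (.of A')) (I : Ideal A)
    (h : ∀ (S' : Scheme.{0}) (g : S' ⟶ Spec ((Spec (.of A)).presheaf.stalk ((Spec.map (CommRingCat.ofHom τ.toRingHom)).base x'))),
      IsBlowup g ((affineBlowup.idealSheaf I).comap ((Spec (.of A)).fromSpecStalk ((Spec.map (CommRingCat.ofHom τ.toRingHom)).base x'))) →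
      (((affineBlowup.idealSheaf I).comap ((Spec (.of A)).fromSpecStalk ((Spec.map (CommRingCat.ofHom τ.toRingHom)).base x'))) ≠ ⊥ ∧
        ((((affineBlowup.idealSheaf I).comap ((Spec (.of A)).fromSpecStalk ((Spec.map (CommRingCat.ofHom τ.toRingHom)).base x'))).support :
          Set (Spec ((Spec (.of A)).presheaf.stalk ((Spec.map (CommRingCat.ofHom τ.toRingHom)).base x')))) ⊆
          (Scheme.regularLocus (Spec ((Spec (.of A)).presheaf.stalk ((Spec.map (CommRingCat.ofHom τ.toRingHom)).base x'))))ᶜ) ∧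
        (∀ s : S', g.base s ≠ closedPoint _ → s ∈ Scheme.regularLocus S') ∧ (∀ s : S', CMCl (S'.presheaf.stalk s))) ∧
      (∃ s : S', g.base s = closedPoint _ ∧ ¬ FullCl p (S'.presheaf.stalk s)) ∧
      (∃ 𝓚 : S'.IdealSheafData, 𝓚 ≠ ⊥ ∧ (∀ s ∈ (𝓚.support : Set S'), g.base s = closedPoint _) ∧
        ∀ (S'' : Scheme.{0}) (π : S'' ⟶ S'), IsBlowup π 𝓚 → ∀ s : S'', FullCl p (S''.presheaf.stalk s))) :
    ∀ (S' : Scheme.{0}) (g' : S' ⟶ Spec ((Spec (.of A')).presheaf.stalk x')),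
      IsBlowup g' ((affineBlowup.idealSheaf (I.map τ.toRingHom)).comap ((Spec (.of A')).fromSpecStalk x')) →
      (((affineBlowup.idealSheaf (I.map τ.toRingHom)).comap ((Spec (.of A')).fromSpecStalk x')) ≠ ⊥ ∧
        ((((affineBlowup.idealSheaf (I.map τ.toRingHom)).comap ((Spec (.of A')).fromSpecStalk x')).support : Set (Spec ((Spec (.of A')).presheaf.stalk x'))) ⊆
          (Scheme.regularLocus (Spec ((Spec (.of A')).presheaf.stalk x')))ᶜ) ∧
        (∀ s : S', g'.base s ≠ closedPoint _ → s ∈ Scheme.regularLocus S') ∧ (∀ s : S', CMCl (S'.presheaf.stalk s))) ∧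
      (∃ s : S', g'.base s = closedPoint _ ∧ ¬ FullCl p (S'.presheaf.stalk s)) ∧
      (∃ 𝓚 : S'.IdealSheafData, 𝓚 ≠ ⊥ ∧ (∀ s ∈ (𝓚.support : Set S'), g'.base s = closedPoint _) ∧
        ∀ (S'' : Scheme.{0}) (π : S'' ⟶ S'), IsBlowup π 𝓚 → ∀ s : S'', FullCl p (S''.presheaf.stalk s)) := by
  obtain ⟨Φ, hΦ, hJ⟩ := exists_germIso_specMap τ x' I
  exact rowShape_transport p Φ hΦ _ _ hJ h

/-- ★ **`FInjectivizationGermAt` along a ring isomorphism**: `FInjectivizationGermAt p ((Spec τ) x′) → FInjectivizationGermAt p x′`. [folklore] -/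
theorem fInjectivizationGermAt_of_ringEquiv (p : ℕ) {A A' : Type} [CommRing A] [CommRing A'] (τ : A ≃+* A') (x' : Spec (.of A'))
    (h : FInjectivizationGermAt p ((Spec.map (CommRingCat.ofHom τ.toRingHom)).base x')) : FInjectivizationGermAt p x' := by
  obtain ⟨Φ, hΦ, -⟩ := exists_germIso_specMap τ x' ⊤
  exact fInjectivizationGermAt_transport p Φ hΦ h

end Summit.ResolutionOfSingularities.ResolutionOfSingularities.Theorems.FInjectiveMacaulayfication.GermRowTransport

end
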